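import Literature.MathematicalPhysics.QuantumFieldTheory.Balaban1983to89.B9Thm315WholeSectE
import Literature.MathematicalPhysics.QuantumFieldTheory.Balaban1983to89.Node00.OpsYRecordV4

/-!
# `Balaban1983to89.B9Thm315WholeSectEOn` — [B9] Theorem 3.15 (p. 432) through the EXPANSION slot with the located reading (O2″) asked ON THE PRINTED PREFIX ONLY
# (dag-ref-E g5 READ-6 hygiene note on `B9Thm315WholeSectE`: «`hread` over-asks — quantified over every converging U, used only on the (3.35)–(3.36) classes»)

T. Bałaban, *Propagators for lattice gauge theories in a background field*, Commun. Math. Phys. **99** (1985) 389–434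
[`Balaban1985BackgroundPropagators`, "B9"].

statement-level skeleton of published theorems with citation tags; proofs where landed; nothing here is a claim about the Yang–Mills mass gap

THE PRINTED LOCUS (verbatim, p. 432 [PDF 44]).  *"For Mα₀ sufficiently small the propagator C^{(k)}(Λ) is given by the formula (3.185), and satisfies the bound
|C^{(k)}(Λ; y, y′)| ≤ B₀e^{−δ₀|y−y′|}, y, y′ ∈ Λ (3.187) … This propagator has a convergent random walk expansion of the type described previously."* — every clause
is stated for configurations `U` in the classes (3.35), (3.36) with `Mα₀` small.

THE POINT.  `B9Thm315WholeSectE.thm315FullPrinted_sectE_of_reading` (p501218) displays the located reading as `hread : ∀ x U, (𝔴 x).EC.Converges U → KernelDominated …` —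
for EVERY configuration at which the walk letter converges — but uses it only under the printed prefix (referee dag-ref-E g5, READ-6).  THIS FILE states the tightened
face: the reading joins the two pinned slots INSIDE the prefix hypothesis `h` (so a supplier proves (O2″) only for regular, `G`-valued `U` with `Mα₀ ≤ a₀`), with the
same proof and constants: ★★ `thm315FullPrinted_sectE_of_reading_on` (+ `thm315Printed_…`), record faces ★★ `t315_opsYSectE_of_reading_on`, ★★
`t315_opsYOfRecordV4E_of_reading_on`; `prefix_reading_of_global` (the p501218 shape of the hypotheses implies the tightened one — the old face is the special
case); `kernelDominated_of_forall_not_inΛ` ∕ `kernelDominated_diag` (at members without Λ-bonds the reading is vacuous — only members with Λ-bonds carry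
row-24 content, as for the (3.185) slot in `B9Thm315WholeSectERepOn`).

HONEST SCOPE.  Count-neutral kernel bookkeeping (a weaker displayed hypothesis); the (3.185) identity, the expansion clause, the reading (O2″), the walk count and the
floor stay DISPLAYED.  Nothing of print asserted; NOT a node discharge (N06 unmoved), NOT summit progress; one finite lattice programme at fixed ε; nothing continuum ∕
ℝ⁴ ∕ OS ∕ mass gap ∕ Clay.  Cell `pub-ymgap` (D-0062), node N06 [B9], bundle F8 row 24 (successor file), seat `pub-ymgap-dag-n06-m` (g4), 2026-08-27.  Imports the
seat's `B9Thm315WholeSectE` and def-Y's `Node00.OpsYRecordV4`; nothing restated.  Net new unproved facts: 0.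
-/

noncomputable section

namespace Literature.MathematicalPhysics.QuantumFieldTheory.Balaban1983to89.B9Thm315WholeSectEOn

open B9 Node00
open B6KLevelCensusIndexV1 (KIdx)
open B9PinMembersKLevelV1 (MemberY geo9Y bg9Y mstar_le_M)
open B9PinCarriersKLevelV1 (OperatorLayerY)
open B9PinGeometryKLevelV1 (inΛY unitDistY c35Y not_inΛY_diag)
open B7Prop2SpecialUnitary (specialUnitaryUnits)
open B9Thm315WholeSectE (KernelDominated KWalkCount half_threshold kernel_bound_of_reading geo9Y_M_pos kterm_le_of_hasRWExpCY hasRWExpCY_mono)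

/-! ## §1 The face at the Sect. E layer with the reading on the prefix -/

section Layer

variable {d ℓ : ℕ} {hd : 1 ≤ d + 1} {hL : Odd (ℓ + 1) ∧ 1 < ℓ + 1} {b₀ b₁ : ℝ} {Mstar : ℕ}
variable {𝔸 : Type} [NormedRing 𝔸] [NormedAlgebra ℂ 𝔸] [CompleteSpace 𝔸] {G : Subgroup 𝔸ˣ}

/-- ★★ **THEOREM 3.15 AS THE WHOLE PRINTED LEAF AT THE SECT. E LAYER THROUGH THE EXPANSION SLOT, THE READING ASKED ON THE PRINTED PREFIX ONLY**: as
`B9Thm315WholeSectE.thm315FullPrinted_sectE_of_reading`, but the located reading (O2″) `KernelDominated (𝔴 x).EC (Ck x) (inΛY x) (W x) U` is the THIRD conjunct of the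
prefix hypothesis `h` (regular `U` in (3.35)–(3.36), `0 < α₀`, `Mα₀ ≤ a₀`) instead of a clause for every converging `U`.  Displayed otherwise: the walk data `W hW hwd
hcnt`, uniform term constants `C₀ c₀`, the floor `2D₀c₀ ≤ M⋆`.  OUTPUT δ₀ = δ′, a₀, B₀ = 2N₀C₀; (3.187) DERIVED (`kernel_bound_of_reading`).  NOT a node discharge.
[cite: Balaban1985BackgroundPropagators, Thm 3.15 (3.185)–(3.187) p.432, Thm 3.9 (3.98)–(3.99) p.413, Cor. 3.8 (3.91) p.410] -/
theorem thm315FullPrinted_sectE_of_reading_on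
    (ops : ∀ x : MemberY d ℓ hd hL b₀ b₁ Mstar, OperatorLayerY d ℓ hd hL b₀ b₁ Mstar 𝔸 G x)
    (𝔏 : ∀ x : MemberY d ℓ hd hL b₀ b₁ Mstar, CovLettersY 𝔸 x) (𝔢 : ∀ x : MemberY d ℓ hd hL b₀ b₁ Mstar, SectELettersY 𝔸 x)
    (𝔴 : ∀ x : MemberY d ℓ hd hL b₀ b₁ Mstar, RWLettersEY 𝔸 G x)
    {a₀ δ₁ δ' C₀ c₀ N₀ D₀ : ℝ} (ha₀ : 0 < a₀) (hδ' : 0 < δ') (hδ'₁ : δ' ≤ δ₁) (hC₀ : 0 < C₀) (hc₀ : 0 < c₀) (hN₀ : 0 < N₀)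
    (hD₀ : 0 < D₀) (hC : ∀ x, (𝔴 x).C ≤ C₀) (hc : ∀ x, (𝔴 x).c ≤ c₀)
    (W : ∀ x : MemberY d ℓ hd hL b₀ b₁ Mstar, ℕ → (geo9Y x).Site → (geo9Y x).Site → Finset (𝔴 x).EC.Walk)
    (hW : ∀ (x : MemberY d ℓ hd hL b₀ b₁ Mstar) (n : ℕ) (y y' : (geo9Y x).Site) (ω : (𝔴 x).EC.Walk), ω ∈ W x n y y' → (𝔴 x).EC.wlen ω = n)
    (hwd : ∀ (x : MemberY d ℓ hd hL b₀ b₁ Mstar) (ω : (𝔴 x).EC.Walk) (y y' : (geo9Y x).Site), 0 ≤ (𝔴 x).EC.wdist ω y y')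
    (hcnt : ∀ x : MemberY d ℓ hd hL b₀ b₁ Mstar, KWalkCount (𝔴 x).EC (W x) (inΛY x) (unitDistY x) N₀ D₀ δ₁ δ')
    (hM : 2 * D₀ * c₀ ≤ (Mstar : ℝ))
    (h : ∀ (x : MemberY d ℓ hd hL b₀ b₁ Mstar) (α₀ : ℝ), 0 < α₀ → (geo9Y x).M * α₀ ≤ a₀ →
      ∀ U : (bg9Y 𝔸 G x).Cfg, (bg9Y 𝔸 G x).Reg335 c35Y α₀ U → (bg9Y 𝔸 G x).Reg336 c35Y α₀ U →
        givenBy3185Y x (𝔏 x) (𝔢 x) U ∧ hasRWExpCY (𝔴 x) U δ₁ ∧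
          KernelDominated (𝔴 x).EC (siteKernelOfOp x.toKIdx (bg9Y 𝔸 G x) (fun U => U) (CkY x (𝔏 x) (𝔢 x)) id id) (inΛY x) (W x) U) :
    B9.Thm315FullPrinted c35Y geo9Y (bg9Y 𝔸 G)
      (fun x => (operatorLayerYSectE 𝔸 G x (ops x) (𝔏 x) (𝔢 x) (𝔴 x)).Ck) inΛY unitDistY
      (fun x => (operatorLayerYSectE 𝔸 G x (ops x) (𝔏 x) (𝔢 x) (𝔴 x)).GivenBy3185)
      (fun x => (operatorLayerYSectE 𝔸 G x (ops x) (𝔏 x) (𝔢 x) (𝔴 x)).HasRWExpC) := by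
  refine ⟨δ', a₀, 2 * N₀ * C₀, hδ', ha₀, by positivity, fun x α₀ hα hMa U hU hU' => ?_⟩
  obtain ⟨h85, hRW, hread⟩ := h x α₀ hα hMa U hU hU'
  have hMpos : 0 < (geo9Y x).M := geo9Y_M_pos x
  refine ⟨h85, hasRWExpCY_mono hδ'₁ (hwd x) hRW, fun y y' hy hy' => ?_⟩
  have hx : D₀ * (c₀ * (geo9Y x).M ^ (-(1 : ℝ))) ≤ 1 / 2 := half_threshold hMpos (hM.trans (mstar_le_M x))
  exact kernel_bound_of_reading hC₀.le hc₀.le hMpos hN₀.le hD₀.le hx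
    (fun ω z z' hz hz' => kterm_le_of_hasRWExpCY hRW le_rfl (hC x) (hc x) (hwd x) ω hz hz')
    (hW x) (hcnt x) hread hy hy'

/-- The bound-only leaf `B9.Thm315Printed` at the same data. [cite: Balaban1985BackgroundPropagators, Thm 3.15 (3.187) p.432] -/
theorem thm315Printed_sectE_of_reading_on
    (ops : ∀ x : MemberY d ℓ hd hL b₀ b₁ Mstar, OperatorLayerY d ℓ hd hL b₀ b₁ Mstar 𝔸 G x)
    (𝔏 : ∀ x : MemberY d ℓ hd hL b₀ b₁ Mstar, CovLettersY 𝔸 x) (𝔢 : ∀ x : MemberY d ℓ hd hL b₀ b₁ Mstar, SectELettersY 𝔸 x)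
    (𝔴 : ∀ x : MemberY d ℓ hd hL b₀ b₁ Mstar, RWLettersEY 𝔸 G x)
    {a₀ δ₁ δ' C₀ c₀ N₀ D₀ : ℝ} (ha₀ : 0 < a₀) (hδ' : 0 < δ') (hδ'₁ : δ' ≤ δ₁) (hC₀ : 0 < C₀) (hc₀ : 0 < c₀) (hN₀ : 0 < N₀)
    (hD₀ : 0 < D₀) (hC : ∀ x, (𝔴 x).C ≤ C₀) (hc : ∀ x, (𝔴 x).c ≤ c₀)
    (W : ∀ x : MemberY d ℓ hd hL b₀ b₁ Mstar, ℕ → (geo9Y x).Site → (geo9Y x).Site → Finset (𝔴 x).EC.Walk)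
    (hW : ∀ (x : MemberY d ℓ hd hL b₀ b₁ Mstar) (n : ℕ) (y y' : (geo9Y x).Site) (ω : (𝔴 x).EC.Walk), ω ∈ W x n y y' → (𝔴 x).EC.wlen ω = n)
    (hwd : ∀ (x : MemberY d ℓ hd hL b₀ b₁ Mstar) (ω : (𝔴 x).EC.Walk) (y y' : (geo9Y x).Site), 0 ≤ (𝔴 x).EC.wdist ω y y')
    (hcnt : ∀ x : MemberY d ℓ hd hL b₀ b₁ Mstar, KWalkCount (𝔴 x).EC (W x) (inΛY x) (unitDistY x) N₀ D₀ δ₁ δ')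
    (hM : 2 * D₀ * c₀ ≤ (Mstar : ℝ))
    (h : ∀ (x : MemberY d ℓ hd hL b₀ b₁ Mstar) (α₀ : ℝ), 0 < α₀ → (geo9Y x).M * α₀ ≤ a₀ →
      ∀ U : (bg9Y 𝔸 G x).Cfg, (bg9Y 𝔸 G x).Reg335 c35Y α₀ U → (bg9Y 𝔸 G x).Reg336 c35Y α₀ U →
        givenBy3185Y x (𝔏 x) (𝔢 x) U ∧ hasRWExpCY (𝔴 x) U δ₁ ∧
          KernelDominated (𝔴 x).EC (siteKernelOfOp x.toKIdx (bg9Y 𝔸 G x) (fun U => U) (CkY x (𝔏 x) (𝔢 x)) id id) (inΛY x) (W x) U) :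
    B9.Thm315Printed c35Y geo9Y (bg9Y 𝔸 G)
      (fun x => (operatorLayerYSectE 𝔸 G x (ops x) (𝔏 x) (𝔢 x) (𝔴 x)).Ck) inΛY unitDistY :=
  B9.thm315_bound_of_full c35Y geo9Y (bg9Y 𝔸 G) _ inΛY unitDistY _ _
    (thm315FullPrinted_sectE_of_reading_on ops 𝔏 𝔢 𝔴 ha₀ hδ' hδ'₁ hC₀ hc₀ hN₀ hD₀ hC hc W hW hwd hcnt hM h)

/-- the p501218 shape of the hypotheses (reading for EVERY converging `U`) implies the tightened shape — the old face is the special case.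
[cite: Balaban1985BackgroundPropagators, Thm 3.15 p.432, bookkeeping] -/
theorem prefix_reading_of_global
    (𝔏 : ∀ x : MemberY d ℓ hd hL b₀ b₁ Mstar, CovLettersY 𝔸 x) (𝔢 : ∀ x : MemberY d ℓ hd hL b₀ b₁ Mstar, SectELettersY 𝔸 x)
    (𝔴 : ∀ x : MemberY d ℓ hd hL b₀ b₁ Mstar, RWLettersEY 𝔸 G x) {a₀ δ₁ : ℝ}
    (W : ∀ x : MemberY d ℓ hd hL b₀ b₁ Mstar, ℕ → (geo9Y x).Site → (geo9Y x).Site → Finset (𝔴 x).EC.Walk)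
    (h : ∀ (x : MemberY d ℓ hd hL b₀ b₁ Mstar) (α₀ : ℝ), 0 < α₀ → (geo9Y x).M * α₀ ≤ a₀ →
      ∀ U : (bg9Y 𝔸 G x).Cfg, (bg9Y 𝔸 G x).Reg335 c35Y α₀ U → (bg9Y 𝔸 G x).Reg336 c35Y α₀ U →
        givenBy3185Y x (𝔏 x) (𝔢 x) U ∧ hasRWExpCY (𝔴 x) U δ₁)
    (hread : ∀ (x : MemberY d ℓ hd hL b₀ b₁ Mstar) (U : (bg9Y 𝔸 G x).Cfg), (𝔴 x).EC.Converges U →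
      KernelDominated (𝔴 x).EC (siteKernelOfOp x.toKIdx (bg9Y 𝔸 G x) (fun U => U) (CkY x (𝔏 x) (𝔢 x)) id id) (inΛY x) (W x) U) :
    ∀ (x : MemberY d ℓ hd hL b₀ b₁ Mstar) (α₀ : ℝ), 0 < α₀ → (geo9Y x).M * α₀ ≤ a₀ →
      ∀ U : (bg9Y 𝔸 G x).Cfg, (bg9Y 𝔸 G x).Reg335 c35Y α₀ U → (bg9Y 𝔸 G x).Reg336 c35Y α₀ U →
        givenBy3185Y x (𝔏 x) (𝔢 x) U ∧ hasRWExpCY (𝔴 x) U δ₁ ∧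
          KernelDominated (𝔴 x).EC (siteKernelOfOp x.toKIdx (bg9Y 𝔸 G x) (fun U => U) (CkY x (𝔏 x) (𝔢 x)) id id) (inΛY x) (W x) U :=
  fun x α₀ hα hMa U hU hU' =>
    ⟨(h x α₀ hα hMa U hU hU').1, (h x α₀ hα hMa U hU hU').2, hread x U (h x α₀ hα hMa U hU hU').2.1⟩

/-- at a member WITHOUT Λ-bonds (every diagonal member, `Λ = ∅`) the located reading is vacuous — as the (3.185) slot there
(`B9Thm315WholeSectERepOn.givenBy3185Y_of_forall_not_inΛ`): only members with Λ-bonds carry row-24 content.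
[cite: Balaban1985BackgroundPropagators, Thm 3.15 p.432, bookkeeping] -/
theorem kernelDominated_of_forall_not_inΛ {x : MemberY d ℓ hd hL b₀ b₁ Mstar} (hΛ : ∀ b : IBondY x.toKIdx, ¬ inΛY x b)
    (EC : RWKernelExpansion (geo9Y x) (bg9Y 𝔸 G x)) (Ck : SiteKernel (geo9Y x) (bg9Y 𝔸 G x))
    (W : ℕ → (geo9Y x).Site → (geo9Y x).Site → Finset EC.Walk) (U : (bg9Y 𝔸 G x).Cfg) : KernelDominated EC Ck (inΛY x) W U :=
  fun y _ hy _ _ _ => absurd hy (hΛ y)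

/-- … in particular at `MemberY.diag i hcf hM`. [cite: Balaban1985BackgroundPropagators, Thm 3.15 p.432, bookkeeping] -/
theorem kernelDominated_diag (i : KIdx d ℓ hd hL b₀ b₁) (hcf : i.cf = (((ℓ + 1 : ℕ) : ℝ)) ^ i.k) (hM : Mstar ≤ (ℓ + 1) * i.Mh)
    (EC : RWKernelExpansion (geo9Y (MemberY.diag i hcf hM : MemberY d ℓ hd hL b₀ b₁ Mstar))
      (bg9Y 𝔸 G (MemberY.diag i hcf hM : MemberY d ℓ hd hL b₀ b₁ Mstar)))
    (Ck : SiteKernel (geo9Y (MemberY.diag i hcf hM : MemberY d ℓ hd hL b₀ b₁ Mstar)) (bg9Y 𝔸 G (MemberY.diag i hcf hM : MemberY d ℓ hd hL b₀ b₁ Mstar)))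
    (W : ℕ → (geo9Y (MemberY.diag i hcf hM : MemberY d ℓ hd hL b₀ b₁ Mstar)).Site →
      (geo9Y (MemberY.diag i hcf hM : MemberY d ℓ hd hL b₀ b₁ Mstar)).Site → Finset EC.Walk)
    (U : (bg9Y 𝔸 G (MemberY.diag i hcf hM : MemberY d ℓ hd hL b₀ b₁ Mstar)).Cfg) :
    KernelDominated EC Ck (inΛY (MemberY.diag i hcf hM : MemberY d ℓ hd hL b₀ b₁ Mstar)) W U :=
  kernelDominated_of_forall_not_inΛ (not_inΛY_diag (Mstar := Mstar) i hcf hM) EC Ck W U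

end Layer

/-! ## §2 Record level -/

section Record

open scoped Matrix.Norms.L2Operator

variable (N : ℕ) (θ : Stage3Params) (Mstar : ℕ)

/-- ★★ **ROW 24 (`t315`) AT THE SECT. E LAYER FAMILY `opsYSectE N θ M⋆ ops 𝔏 𝔢 𝔴`, EXPANSION SLOT, READING ON THE PREFIX** (generic base family and letters).
[cite: Balaban1985BackgroundPropagators, Thm 3.15 (3.185)–(3.187) p.432, Thm 3.9 (3.98)–(3.99) p.413, Cor. 3.8 (3.91) p.410] -/
theorem t315_opsYSectE_of_reading_on (ops : OpsY N θ Mstar) (𝔏 : LettersY N θ Mstar) (𝔢 : SectEY N θ Mstar) (𝔴 : RWEY N θ Mstar)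
    {a₀ δ₁ δ' C₀ c₀ N₀ D₀ : ℝ} (ha₀ : 0 < a₀) (hδ' : 0 < δ') (hδ'₁ : δ' ≤ δ₁) (hC₀ : 0 < C₀) (hc₀ : 0 < c₀) (hN₀ : 0 < N₀)
    (hD₀ : 0 < D₀) (hC : ∀ x, (𝔴 x).C ≤ C₀) (hc : ∀ x, (𝔴 x).c ≤ c₀)
    (W : ∀ x : MemberY θ.d₆ θ.ℓ₆ θ.hd' θ.hL' θ.b₀ θ.b₁ Mstar, ℕ → (geo9Y x).Site → (geo9Y x).Site → Finset (𝔴 x).EC.Walk)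
    (hW : ∀ (x : MemberY θ.d₆ θ.ℓ₆ θ.hd' θ.hL' θ.b₀ θ.b₁ Mstar) (n : ℕ) (y y' : (geo9Y x).Site) (ω : (𝔴 x).EC.Walk),
      ω ∈ W x n y y' → (𝔴 x).EC.wlen ω = n)
    (hwd : ∀ (x : MemberY θ.d₆ θ.ℓ₆ θ.hd' θ.hL' θ.b₀ θ.b₁ Mstar) (ω : (𝔴 x).EC.Walk) (y y' : (geo9Y x).Site), 0 ≤ (𝔴 x).EC.wdist ω y y')
    (hcnt : ∀ x : MemberY θ.d₆ θ.ℓ₆ θ.hd' θ.hL' θ.b₀ θ.b₁ Mstar, KWalkCount (𝔴 x).EC (W x) (inΛY x) (unitDistY x) N₀ D₀ δ₁ δ')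
    (hM : 2 * D₀ * c₀ ≤ (Mstar : ℝ))
    (h : ∀ (x : MemberY θ.d₆ θ.ℓ₆ θ.hd' θ.hL' θ.b₀ θ.b₁ Mstar) (α₀ : ℝ), 0 < α₀ → (geo9Y x).M * α₀ ≤ a₀ →
      ∀ U : (bg9Y (Matrix (Fin N) (Fin N) ℂ) (specialUnitaryUnits (Fin N)) x).Cfg,
        (bg9Y (Matrix (Fin N) (Fin N) ℂ) (specialUnitaryUnits (Fin N)) x).Reg335 c35Y α₀ U →
        (bg9Y (Matrix (Fin N) (Fin N) ℂ) (specialUnitaryUnits (Fin N)) x).Reg336 c35Y α₀ U →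
          givenBy3185Y x (𝔏 x) (𝔢 x) U ∧ hasRWExpCY (𝔴 x) U δ₁ ∧
            KernelDominated (𝔴 x).EC (siteKernelOfOp x.toKIdx (bg9Y (Matrix (Fin N) (Fin N) ℂ) (specialUnitaryUnits (Fin N)) x) (fun U => U)
              (CkY x (𝔏 x) (𝔢 x)) id id) (inΛY x) (W x) U) :
    B9.Thm315FullPrinted c35Y geo9Y (bg9Y (Matrix (Fin N) (Fin N) ℂ) (specialUnitaryUnits (Fin N)))
      (fun x => (opsYSectE N θ Mstar ops 𝔏 𝔢 𝔴 x).Ck) inΛY unitDistY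
      (fun x => (opsYSectE N θ Mstar ops 𝔏 𝔢 𝔴 x).GivenBy3185) (fun x => (opsYSectE N θ Mstar ops 𝔏 𝔢 𝔴 x).HasRWExpC) :=
  thm315FullPrinted_sectE_of_reading_on ops 𝔏 𝔢 𝔴 ha₀ hδ' hδ'₁ hC₀ hc₀ hN₀ hD₀ hC hc W hW hwd hcnt hM h

/-- ★★ **ROW 24 (`t315`) AT def-Y's v4 INSTANCE OF RECORD `opsYOfRecordV4E N θ M⋆ 𝔯 𝔢 𝔴 𝔈`, EXPANSION SLOT, READING ON THE PREFIX** (binder VERBATIM; for n06-d's FILE 28: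
same binders as `B9Thm314Thm315RecordV4.t315_opsYOfRecordV4E_of_reading` with `hread` folded into `h`).
[cite: Balaban1985BackgroundPropagators, Thm 3.15 (3.185)–(3.187) p.432, Thm 3.9 (3.98)–(3.99) p.413, Cor. 3.8 (3.91) p.410] -/
theorem t315_opsYOfRecordV4E_of_reading_on (𝔯 : ResY N θ Mstar) (𝔢 : SectEY N θ Mstar) (𝔴 : RWEY N θ Mstar) (𝔈 : ExpsY N θ Mstar)
    {a₀ δ₁ δ' C₀ c₀ N₀ D₀ : ℝ} (ha₀ : 0 < a₀) (hδ' : 0 < δ') (hδ'₁ : δ' ≤ δ₁) (hC₀ : 0 < C₀) (hc₀ : 0 < c₀) (hN₀ : 0 < N₀)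
    (hD₀ : 0 < D₀) (hC : ∀ x, (𝔴 x).C ≤ C₀) (hc : ∀ x, (𝔴 x).c ≤ c₀)
    (W : ∀ x : MemberY θ.d₆ θ.ℓ₆ θ.hd' θ.hL' θ.b₀ θ.b₁ Mstar, ℕ → (geo9Y x).Site → (geo9Y x).Site → Finset (𝔴 x).EC.Walk)
    (hW : ∀ (x : MemberY θ.d₆ θ.ℓ₆ θ.hd' θ.hL' θ.b₀ θ.b₁ Mstar) (n : ℕ) (y y' : (geo9Y x).Site) (ω : (𝔴 x).EC.Walk),
      ω ∈ W x n y y' → (𝔴 x).EC.wlen ω = n)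
    (hwd : ∀ (x : MemberY θ.d₆ θ.ℓ₆ θ.hd' θ.hL' θ.b₀ θ.b₁ Mstar) (ω : (𝔴 x).EC.Walk) (y y' : (geo9Y x).Site), 0 ≤ (𝔴 x).EC.wdist ω y y')
    (hcnt : ∀ x : MemberY θ.d₆ θ.ℓ₆ θ.hd' θ.hL' θ.b₀ θ.b₁ Mstar, KWalkCount (𝔴 x).EC (W x) (inΛY x) (unitDistY x) N₀ D₀ δ₁ δ')
    (hM : 2 * D₀ * c₀ ≤ (Mstar : ℝ))
    (h : ∀ (x : MemberY θ.d₆ θ.ℓ₆ θ.hd' θ.hL' θ.b₀ θ.b₁ Mstar) (α₀ : ℝ), 0 < α₀ → (geo9Y x).M * α₀ ≤ a₀ →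
      ∀ U : (bg9Y (Matrix (Fin N) (Fin N) ℂ) (specialUnitaryUnits (Fin N)) x).Cfg,
        (bg9Y (Matrix (Fin N) (Fin N) ℂ) (specialUnitaryUnits (Fin N)) x).Reg335 c35Y α₀ U →
        (bg9Y (Matrix (Fin N) (Fin N) ℂ) (specialUnitaryUnits (Fin N)) x).Reg336 c35Y α₀ U →
          givenBy3185Y x (lettersYOfRecordV4 N θ Mstar 𝔯 x) (𝔢 x) U ∧ hasRWExpCY (𝔴 x) U δ₁ ∧
            KernelDominated (𝔴 x).EC (siteKernelOfOp x.toKIdx (bg9Y (Matrix (Fin N) (Fin N) ℂ) (specialUnitaryUnits (Fin N)) x) (fun U => U)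
              (CkY x (lettersYOfRecordV4 N θ Mstar 𝔯 x) (𝔢 x)) id id) (inΛY x) (W x) U) :
    B9.Thm315FullPrinted c35Y geo9Y (bg9Y (Matrix (Fin N) (Fin N) ℂ) (specialUnitaryUnits (Fin N)))
      (fun x => (opsYOfRecordV4E N θ Mstar 𝔯 𝔢 𝔴 𝔈 x).Ck) inΛY unitDistY
      (fun x => (opsYOfRecordV4E N θ Mstar 𝔯 𝔢 𝔴 𝔈 x).GivenBy3185) (fun x => (opsYOfRecordV4E N θ Mstar 𝔯 𝔢 𝔴 𝔈 x).HasRWExpC) :=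
  t315_opsYSectE_of_reading_on N θ Mstar (opsYS349OfRecordV4 N θ Mstar 𝔯 𝔈) (lettersYOfRecordV4 N θ Mstar 𝔯) 𝔢 𝔴
    ha₀ hδ' hδ'₁ hC₀ hc₀ hN₀ hD₀ hC hc W hW hwd hcnt hM h

end Record

end Literature.MathematicalPhysics.QuantumFieldTheory.Balaban1983to89.B9Thm315WholeSectEOn

end
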